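import Literature.Topology.FourManifolds.CappellShanesonDedekindKummerExponent
import Literature.Topology.FourManifolds.CappellShanesonTotallyReal
import Literature.NumberTheory.NumberFields.IntegralBasisOfFamily
import Literature.Topology.FourManifolds.CappellShanesonIdealCertificates
import HarnessLib

/-!
# The trace `76` Cappell–Shaneson field: the maximal order `ℤ ⊕ ℤθ ⊕ ℤη`, `η = (θ - 2)²/7`
# (Kim–Yamada, Prop. 4.11, `k = 1`), index `7`, discriminant `594881 = 7 · 17 · 4999`,
# Dedekind–Kummer away from `7`, and the conductor square `𝓞 K/(7, θ - 2) ≅ 𝔽₇ × 𝔽₇`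

K. Iwaki, *Infinite families of standard Cappell–Shaneson homotopy 4-spheres*, Topology Appl. 366
(2025) 109293 (arXiv:2404.05096), §4.3, tabulates the ideal class monoids `C(ℤ[θₙ])` of the orders
`ℤ[θₙ] = ℤ[x]/(fₙ)`, `fₙ = x³ - nx² + (n-1)x - 1`, for `70 ≤ n ≤ 78`; the rows `70–75`, `77`, `78`
are certified in the tree (`CappellShanesonClassGroupSeventy*.lean`, …) through the class group of
the MAXIMAL order `ℤ[θₙ] = 𝓞 K`.  The row `n = 76` ("`76 35 (1,1,76), (2,3,76), …, (46,173,76)`") is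
the one trace of that window whose order is NOT maximal: `76 = 49 · 1 + 27` belongs to Kim–Yamada's
family (M. H. Kim, S. Yamada, Kyungpook Math. J. 63 (2023) 373–411, §4.2, Prop. 4.10/4.11:
"`η_k = (Θ_{49k+27} - 2)²/7` is an algebraic integer … `ℤ[Θ_{49k+27}]` is not integrally closed";
Iwaki, Ex. 3.13: `(c, p, n₀) = (2, 7, 27)`, `n = 7²k + 27`).  This file is the first part of the
certification of that row: the MAXIMAL ORDER of the trace-`76` field, made explicit.  Unlike the
trace `27` (`CappellShanesonTwentysevenIntegers.lean`: `𝓞 K = ℤ[ω]`, class number one) the maximal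
order here is not monogenic in any small generator (the index form `7a³ + 140a²b + 669ab² - 313b³`
of the basis below does not take the values `±1` for `|b| ≤ 2·10⁵`), so it is presented by an
integral basis and Marcus's discriminant criterion for FAMILIES (`IntegralBasisOfFamily.lean`).

## The number theory (for a cubic number field `K` with a root `θ` of `f₇₆ = x³ - 76x² + 75x - 1`)

* `η = (θ - 2)²/7` is a root of `x³ - 762x² + 541x - 63` (`aeval_eta_seventysix`), hence an
  algebraic integer; `θη = 72η + 31θ - 41`, `η² = 731η + 313θ - 416` (`thetaInt_mul_etaInt_…`,
  `etaInt_sq_…`): `ℤ ⊕ ℤθ ⊕ ℤη` is a ring.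
* `disc(1, θ, η) = Δ(f₇₆)/49 = 29149169/49 = 594881 = 7 · 17 · 4999` is squarefree, so
  **`1, θ, η` is an integral basis** (`exists_int_coords_seventysix`) and **`d_K = 594881`**
  (`discr_eq_seventysix`); in particular `7 · 𝓞 K ⊆ ℤ[θ]` (`seven_mul_mem_adjoin_theta_seventysix`)
  while `η ∉ ℤ[θ]` (`adjoin_thetaInt_ne_top_seventysix`): **`[𝓞 K : ℤ[θ]] = 7`** (Kim–Yamada,
  Prop. 4.11 for `k = 1`).
* Consequently Dedekind–Kummer applies at every prime `p ≠ 7`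
  (`not_dvd_exponent_seventysix`, with `CappellShanesonDedekindKummerExponent.lean`).
* `ω = η - 10θ = (θ² - 74θ + 4)/7` is a root of the irreducible `x³ - 2x² - 109x + 47`
  (`aeval_omega_seventysix`) with `3θ = ω² + 9ω - 4`, `3η = 10ω² + 93ω - 40`, so `3 · 𝓞 K ⊆ ℤ[ω]`
  (`three_mul_mem_adjoin_omega_seventysix`): through the order `ℤ[ω]` (index `3`, prime to `7`) the
  two **residue maps `ψ : 𝓞 K → 𝔽₇` at the primes above `7`** are constructed
  (`exists_ringHom_zmod_seven_seventysix`: `θ ↦ 2` and `η ↦ 0`, resp. `η ↦ 3`; `f₇₆ ≡ (x - 2)³`,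
  `x³ - 762x² + 541x - 63 ≡ x(x - 3)² (mod 7)`), and their common kernel is the conductor ideal
  `(7, θ - 2) 𝓞 K = 7 𝓞 K + (θ - 2) 𝓞 K ⊆ ℤ[θ]` (`exists_of_residues_eq_zero_seventysix`): the
  "conductor square" `𝓞 K/(7, θ - 2) ≅ 𝔽₇ × 𝔽₇` used by the lattice method of
  `CappellShanesonTwentysevenIdealClasses.lean`.
* `K` is totally real, `d_K = 594881 < 772²`, `⌊M_K⌋ = ⌊(2/9)√594881⌋ ≤ 171`
  (`floor_minkowskiBound_le_seventysix`).

Everything is PROVED (no `def`, no named fact; D-0026).  The numerical data were cross-checked with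
PARI/GP (`nfbasis`, `nfdisc`, `bnfcertify`); only their verification is part of the proofs.

## References

* [KimYamada2023] M. H. Kim, S. Yamada, *Ideal classes and Cappell–Shaneson homotopy 4-spheres*,
  Kyungpook Math. J. 63 (2023) 373–411 (arXiv:1707.03860): §4.2 Prop. 4.10, Prop. 4.11 (`η_k =
  (Θ_{49k+27} - 2)²/7` is integral, `ℤ[Θ_{49k+27}]` is not integrally closed), §4.3.
* [Iwaki2025] K. Iwaki, Topology Appl. 366 (2025) 109293 (arXiv:2404.05096): §4.3 (Table, row
  `n = 76`), Ex. 3.13 (`(c,p,n₀) = (2,7,27)`), Thm. 3.11.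
* [Marcus2018] D. A. Marcus, *Number Fields*, 2nd ed. (2018): Ch. 2, Thm. 9 and Exercise 27 (integral
  bases and discriminants); Ch. 3, Thm. 27 and Ex. 3.20 (Dedekind–Kummer, the conductor); Ch. 5,
  Cor. 2 of Thm. 37 (Minkowski bound).
-/

noncomputable section

open Polynomial Module NumberField Ideal
open scoped NumberField

namespace Literature.Topology.FourManifolds

open Literature.NumberTheory.NumberFields

section Field

variable {K : Type*} [Field K] [NumberField K] {θ : K}

/-! ### The cubic relation, `η = (θ - 2)²/7` and `ω = (θ² - 74θ + 4)/7` -/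

omit [NumberField K] in
/-- The relation `θ³ = 76θ² - 75θ + 1` of a root of `f₇₆ = x³ - 76x² + 75x - 1`.
[cite: Iwaki2025, §4.3 (Table, row n = 76: f₇₆ = x³ - 76x² + 75x - 1)] -/
theorem theta_rel_seventysix (hθ : aeval θ (csPoly 76) = 0) :
    θ ^ 3 - 76 * θ ^ 2 + 75 * θ - 1 = 0 := by
  have h := hθ
  simp only [csPoly, map_sub, map_add, map_mul, map_pow, aeval_X, map_one, eq_intCast,
    map_intCast] at h
  push_cast at h
  linear_combination h

/-- **Kim–Yamada, Prop. 4.11 for `k = 1`: `η = (θ - 2)²/7` is an algebraic integer** — a root of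
`x³ - 762x² + 541x - 63` (`343 · g(η) = f₇₆(θ) · (θ³ + 64θ² - 485θ + 853)`).
[cite: KimYamada2023, §4.2 Prop. 4.11 (η_k = (Θ_{49k+27} - 2)²/7 is integral)] -/
theorem aeval_eta_seventysix (hθ : aeval θ (csPoly 76) = 0) :
    aeval ((θ - 2) ^ 2 / 7) (MonicCubic.poly (-762) 541 (-63)) = 0 := by
  have hrel := theta_rel_seventysix hθ
  set η : K := (θ - 2) ^ 2 / 7 with hη
  have hη7 : 7 * η = (θ - 2) ^ 2 := by rw [hη]; field_simp
  have key : (343 : K) * (η ^ 3 - 762 * η ^ 2 + 541 * η - 63) = 0 := by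
    have : (343 : K) * (η ^ 3 - 762 * η ^ 2 + 541 * η - 63) =
        (7 * η) ^ 3 - 5334 * (7 * η) ^ 2 + 26509 * (7 * η) - 21609 := by ring
    rw [this, hη7]
    linear_combination (θ ^ 3 + 64 * θ ^ 2 - 485 * θ + 853) * hrel
  have h343 : (343 : K) ≠ 0 := by norm_num
  have key' : η ^ 3 - 762 * η ^ 2 + 541 * η - 63 = 0 := by
    rcases mul_eq_zero.mp key with h | h
    · exact absurd h h343
    · exact h
  simp only [MonicCubic.poly, map_add, map_mul, map_pow, aeval_X, eq_intCast, map_intCast]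
  push_cast
  linear_combination key'

/-- **`ω = (θ² - 74θ + 4)/7 = η - 10θ` is a root of `g = x³ - 2x² - 109x + 47`** (an algebraic
integer generating an order of index `3` in `𝓞 K`, prime to the index `7` of `ℤ[θ]`; `343 · g(ω) =
f₇₆(θ) · (θ³ - 146θ² + 5255θ + 5403)`). [cite: KimYamada2023, §4.2 Prop. 4.11 (proof)] -/
theorem aeval_omega_seventysix (hθ : aeval θ (csPoly 76) = 0) :
    aeval ((θ ^ 2 - 74 * θ + 4) / 7) (MonicCubic.poly (-2) (-109) 47) = 0 := by
  have hrel := theta_rel_seventysix hθ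
  set ω : K := (θ ^ 2 - 74 * θ + 4) / 7 with hω
  have hω7 : 7 * ω = θ ^ 2 - 74 * θ + 4 := by rw [hω]; field_simp
  have key : (343 : K) * (ω ^ 3 - 2 * ω ^ 2 - 109 * ω + 47) = 0 := by
    have : (343 : K) * (ω ^ 3 - 2 * ω ^ 2 - 109 * ω + 47) =
        (7 * ω) ^ 3 - 14 * (7 * ω) ^ 2 - 5341 * (7 * ω) + 16121 := by ring
    rw [this, hω7]
    linear_combination (θ ^ 3 - 146 * θ ^ 2 + 5255 * θ + 5403) * hrel
  have h343 : (343 : K) ≠ 0 := by norm_num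
  have key' : ω ^ 3 - 2 * ω ^ 2 - 109 * ω + 47 = 0 := by
    rcases mul_eq_zero.mp key with h | h
    · exact absurd h h343
    · exact h
  simp only [MonicCubic.poly, map_add, map_mul, map_pow, aeval_X, eq_intCast, map_intCast,
    map_neg]
  push_cast
  linear_combination key'

/-- `g = x³ - 2x² - 109x + 47` is irreducible over `ℚ` (no root modulo `2`: `g ≡ x³ + x + 1`).
[cite: Marcus2018, Ch. 3, Thm. 27] -/
theorem irreducible_polyQ_omega_seventysix : Irreducible (MonicCubic.polyQ (-2) (-109) 47) :=
  MonicCubic.irreducible_polyQ_of_no_root (p := 2) (hp := ⟨Nat.prime_two⟩) (by decide)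

/-- `f₇₆`, as the generic monic cubic `poly (-76) 75 (-1)`, is irreducible over `ℚ`.
[cite: KimYamada2023, §2.3 (fₙ is irreducible)] -/
theorem irreducible_polyQ_seventysix : Irreducible (MonicCubic.polyQ (-76) 75 (-1)) :=
  MonicCubic.irreducible_polyQ_of_no_root (p := 2) (hp := ⟨Nat.prime_two⟩) (by decide)

omit [NumberField K] in
/-- A root of `f₇₆` is a root of `poly (-76) 75 (-1)` (`csPoly_eq_poly`). [folklore] -/
private theorem aeval_poly_seventysix (hθ : aeval θ (csPoly 76) = 0) :
    aeval θ (MonicCubic.poly (-76) 75 (-1)) = 0 := by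
  have h := aeval_poly_of_aeval_csPoly hθ
  norm_num at h
  exact h

/-! ### The elements `θ`, `η`, `ω` of `𝓞 K` and their multiplication table -/

/-- `7η = (θ - 2)²` in `𝓞 K` (`η` = `MonicCubic.thetaInt (aeval_eta_seventysix hθ)`).
[cite: KimYamada2023, §4.2 Prop. 4.11] -/
theorem seven_mul_etaInt_seventysix (hθ : aeval θ (csPoly 76) = 0) :
    7 * MonicCubic.thetaInt (aeval_eta_seventysix hθ) = (thetaInt hθ - 2) ^ 2 := by
  apply RingOfIntegers.ext
  simp only [thetaInt, MonicCubic.thetaInt, map_sub, map_mul,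
    map_pow, map_ofNat, RingOfIntegers.map_mk]
  field_simp

/-- `ω = η - 10θ` in `𝓞 K` (`ω` = `MonicCubic.thetaInt (aeval_omega_seventysix hθ)`).
[cite: KimYamada2023, §4.2 Prop. 4.11 (proof)] -/
theorem omegaInt_eq_seventysix (hθ : aeval θ (csPoly 76) = 0) :
    MonicCubic.thetaInt (aeval_omega_seventysix hθ) =
      MonicCubic.thetaInt (aeval_eta_seventysix hθ) - 10 * thetaInt hθ := by
  apply RingOfIntegers.ext
  simp only [thetaInt, MonicCubic.thetaInt, RingOfIntegers.coe_eq_algebraMap, map_sub, map_mul,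
    map_ofNat, RingOfIntegers.map_mk]
  field_simp
  ring

/-- The cubic relation `θ³ - 76θ² + 75θ - 1 = 0` in `𝓞 K`. [cite: Iwaki2025, §4.3 (Table, row n = 76)] -/
theorem thetaInt_rel_seventysix (hθ : aeval θ (csPoly 76) = 0) :
    (thetaInt hθ) ^ 3 - 76 * (thetaInt hθ) ^ 2 + 75 * thetaInt hθ - 1 = 0 := by
  have rel := thetaInt_rel hθ
  push_cast at rel
  linear_combination rel

/-- **`θη = 72η + 31θ - 41`** (`7 ·` this is `θ(θ - 2)² - 72(θ - 2)² - 217θ + 287 = f₇₆(θ)`).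
[cite: KimYamada2023, §4.2 Prop. 4.11 (proof)] -/
theorem thetaInt_mul_etaInt_seventysix (hθ : aeval θ (csPoly 76) = 0) :
    thetaInt hθ * MonicCubic.thetaInt (aeval_eta_seventysix hθ) =
      72 * MonicCubic.thetaInt (aeval_eta_seventysix hθ) + 31 * thetaInt hθ - 41 := by
  have rel := thetaInt_rel_seventysix hθ
  have he := seven_mul_etaInt_seventysix hθ
  set t := thetaInt hθ
  set e := MonicCubic.thetaInt (aeval_eta_seventysix hθ)
  have h7 : (7 : 𝓞 K) ≠ 0 := by exact_mod_cast (by norm_num : (7 : ℕ) ≠ 0)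
  refine mul_left_cancel₀ h7 ?_
  linear_combination (t - 72) * he + (1 : 𝓞 K) * rel

/-- **`η² = 731η + 313θ - 416`**. [cite: KimYamada2023, §4.2 Prop. 4.11 (proof)] -/
theorem etaInt_sq_seventysix (hθ : aeval θ (csPoly 76) = 0) :
    MonicCubic.thetaInt (aeval_eta_seventysix hθ) ^ 2 =
      731 * MonicCubic.thetaInt (aeval_eta_seventysix hθ) + 313 * thetaInt hθ - 416 := by
  have rel := thetaInt_rel_seventysix hθ
  have he := seven_mul_etaInt_seventysix hθ
  set t := thetaInt hθ
  set e := MonicCubic.thetaInt (aeval_eta_seventysix hθ)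
  have h49 : (7 : 𝓞 K) ^ 2 ≠ 0 := pow_ne_zero 2 (by exact_mod_cast (by norm_num : (7 : ℕ) ≠ 0))
  refine mul_left_cancel₀ h49 ?_
  linear_combination (t ^ 2 - 4 * t + 7 * e - 5113) * he + (t + 68) * rel

/-- `3θ = ω² + 9ω - 4` in `𝓞 K` (`θ` in the `ω`-frame; `[𝓞 K : ℤ[ω]] = 3`).
[cite: KimYamada2023, §4.2 Prop. 4.11 (proof)] -/
theorem three_mul_thetaInt_seventysix (hθ : aeval θ (csPoly 76) = 0) :
    3 * thetaInt hθ = MonicCubic.thetaInt (aeval_omega_seventysix hθ) ^ 2 +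
      9 * MonicCubic.thetaInt (aeval_omega_seventysix hθ) - 4 := by
  apply RingOfIntegers.ext
  have hrel := theta_rel_seventysix hθ
  simp only [thetaInt, MonicCubic.thetaInt, map_sub, map_mul,
    map_add, map_pow, map_ofNat, RingOfIntegers.map_mk]
  set ω : K := (θ ^ 2 - 74 * θ + 4) / 7 with hω
  have hω7 : 7 * ω = θ ^ 2 - 74 * θ + 4 := by rw [hω]; field_simp
  have h49 : (49 : K) ≠ 0 := by norm_num
  have key : (49 : K) * (3 * θ) = 49 * (ω ^ 2 + 9 * ω - 4) := by
    have : (49 : K) * (ω ^ 2 + 9 * ω - 4) = (7 * ω) ^ 2 + 63 * (7 * ω) - 196 := by ring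
    rw [this, hω7]
    linear_combination (-(θ - 72)) * hrel
  exact mul_left_cancel₀ h49 key

/-- `3η = 10ω² + 93ω - 40` in `𝓞 K`. [cite: KimYamada2023, §4.2 Prop. 4.11 (proof)] -/
theorem three_mul_etaInt_seventysix (hθ : aeval θ (csPoly 76) = 0) :
    3 * MonicCubic.thetaInt (aeval_eta_seventysix hθ) =
      10 * MonicCubic.thetaInt (aeval_omega_seventysix hθ) ^ 2 +
        93 * MonicCubic.thetaInt (aeval_omega_seventysix hθ) - 40 := by
  apply RingOfIntegers.ext
  have hrel := theta_rel_seventysix hθ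
  simp only [MonicCubic.thetaInt, map_sub, map_mul,
    map_add, map_pow, map_ofNat, RingOfIntegers.map_mk]
  set ω : K := (θ ^ 2 - 74 * θ + 4) / 7 with hω
  have hω7 : 7 * ω = θ ^ 2 - 74 * θ + 4 := by rw [hω]; field_simp
  set η : K := (θ - 2) ^ 2 / 7 with hη
  have hη7 : 7 * η = (θ - 2) ^ 2 := by rw [hη]; field_simp
  have h49 : (49 : K) ≠ 0 := by norm_num
  have key : (49 : K) * (3 * η) = 49 * (10 * ω ^ 2 + 93 * ω - 40) := by
    have e1 : (49 : K) * (3 * η) = 21 * (7 * η) := by ring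
    have e2 : (49 : K) * (10 * ω ^ 2 + 93 * ω - 40) = 10 * (7 * ω) ^ 2 + 651 * (7 * ω) - 1960 := by
      ring
    rw [e1, e2, hω7, hη7]
    linear_combination (-(10 * θ - 720)) * hrel
  exact mul_left_cancel₀ h49 key

/-! ### `1, θ, η` is an integral basis: `disc(1, θ, η) = 594881` is squarefree -/

/-- `Δ(f₇₆) = 76·74·73·71 - 23 = 29149169 = 7³ · 17 · 4999`. [cite: KimYamada2023, §3 (Δ(fₙ) = n(n-2)(n-3)(n-5) - 23)] -/
theorem csDisc_seventysix : csDisc 76 = 29149169 := by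
  decide

/-- **`disc(1, θ, η) = Δ(f₇₆)/7² = 594881`**: the family `1, θ, η` is the power basis times the
matrix `((1,0,4/7),(0,1,-4/7),(0,0,1/7))` of determinant `1/7`. [cite: Marcus2018, Ch. 2, Exercise 27(c)] -/
theorem discr_one_theta_eta_seventysix (hθ : aeval θ (csPoly 76) = 0) (h3 : finrank ℚ K = 3) :
    Algebra.discr ℚ (fun i => ((![1, thetaInt hθ, MonicCubic.thetaInt (aeval_eta_seventysix hθ)] i :
      𝓞 K) : K)) = 594881 := by
  classical
  set P : Matrix (Fin 3) (Fin 3) ℚ := !![1, 0, 4/7; 0, 1, -4/7; 0, 0, 1/7] with hP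
  have hvec : Matrix.vecMul (⇑(csBasis hθ h3)) (P.map (algebraMap ℚ K)) =
      fun i => ((![1, thetaInt hθ, MonicCubic.thetaInt (aeval_eta_seventysix hθ)] i : 𝓞 K) : K) := by
    funext i
    fin_cases i
    · simp [Matrix.vecMul, dotProduct, Fin.sum_univ_three, csBasis_apply, hP]
    · simp [Matrix.vecMul, dotProduct, Fin.sum_univ_three, csBasis_apply, hP, thetaInt]
    · simp [Matrix.vecMul, dotProduct, Fin.sum_univ_three, csBasis_apply, hP, MonicCubic.thetaInt]
      ring
  have hdet : P.det = 1 / 7 := by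
    rw [hP, Matrix.det_fin_three]
    simp
  rw [← hvec, Algebra.discr_of_matrix_vecMul, discr_csBasis hθ h3, csDisc_seventysix, hdet]
  norm_num

set_option maxRecDepth 8192 in
/-- `594881 = 7 · 17 · 4999` is squarefree: no factorisation `r² e` with `|e| > 2`, `r ≠ ±1`.
[cite: Marcus2018, Ch. 2, Exercise 27(e)] -/
theorem discr_seventysix_sq : ∀ r e : ℤ, (594881 : ℤ) = r ^ 2 * e → 2 < |e| → IsUnit r :=
  isUnit_of_eq_sq_mul (B := 771) (by decide) (by decide) (by decide)

/-- The determinant of the coordinates of `1, θ, η` on an integral basis is a unit.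
[cite: Marcus2018, Ch. 2, Exercise 27(e)] -/
theorem isUnit_det_one_theta_eta_seventysix (hθ : aeval θ (csPoly 76) = 0) (h3 : finrank ℚ K = 3)
    (e : Free.ChooseBasisIndex ℤ (𝓞 K) ≃ Fin 3) :
    IsUnit (((RingOfIntegers.basis K).reindex e).det
      ![1, thetaInt hθ, MonicCubic.thetaInt (aeval_eta_seventysix hθ)]) :=
  isUnit_det_family_of_discr_eq e _ (by rw [h3]; norm_num) 594881
    (discr_one_theta_eta_seventysix hθ h3) discr_seventysix_sq

/-- An integral basis of the cubic field `K` is indexed by a type of cardinality `3`. [cite: Marcus2018, Ch. 2, Thm. 9] -/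
theorem exists_equiv_fin_three_seventysix (h3 : finrank ℚ K = 3) :
    Nonempty (Free.ChooseBasisIndex ℤ (𝓞 K) ≃ Fin 3) :=
  ⟨Fintype.equivOfCardEq (by rw [card_chooseBasisIndex_eq_finrank, h3, Fintype.card_fin])⟩

/-- **`1, θ, η` is an integral basis: every algebraic integer of `K` is `u + vθ + wη` with
`u, v, w ∈ ℤ`** (`disc(1, θ, η) = 594881` squarefree; Marcus, Ex. 2.27(e)).
[cite: KimYamada2023, §4.2 Prop. 4.11 (ℤ[Θ₇₆] has index 7 in the maximal order ℤ[Θ₇₆, η₁])] -/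
theorem exists_int_coords_seventysix (hθ : aeval θ (csPoly 76) = 0) (h3 : finrank ℚ K = 3)
    (x : 𝓞 K) : ∃ u v w : ℤ,
      x = u + v * thetaInt hθ + w * MonicCubic.thetaInt (aeval_eta_seventysix hθ) := by
  obtain ⟨e⟩ := exists_equiv_fin_three_seventysix (K := K) h3
  obtain ⟨c, hc⟩ := exists_sum_smul_eq_of_isUnit_det e _
    (isUnit_det_one_theta_eta_seventysix hθ h3 e) x
  refine ⟨c 0, c 1, c 2, ?_⟩
  rw [← hc, Fin.sum_univ_three]
  simp only [Matrix.cons_val_zero, Matrix.cons_val_one, Matrix.cons_val_two, Matrix.head_cons,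
    Matrix.tail_cons, zsmul_eq_mul, mul_one]

/-- **`d_K = 594881 = 7 · 17 · 4999`** for the trace `76` field. [cite: Marcus2018, Ch. 2, Exercise 27(d)] -/
theorem discr_eq_seventysix (hθ : aeval θ (csPoly 76) = 0) (h3 : finrank ℚ K = 3) :
    NumberField.discr K = 594881 := by
  obtain ⟨e⟩ := exists_equiv_fin_three_seventysix (K := K) h3
  exact discr_eq_of_isUnit_det_family e _ (isUnit_det_one_theta_eta_seventysix hθ h3 e) 594881
    (discr_one_theta_eta_seventysix hθ h3)

/-! ### The index `[𝓞 K : ℤ[θ]] = 7`: `7 · 𝓞 K ⊆ ℤ[θ] ∌ η` -/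

/-- **`7 · 𝓞 K ⊆ ℤ[θ]`**: `7(u + vθ + wη) = 7u + 7vθ + w(θ - 2)²`.
[cite: KimYamada2023, §4.2 Prop. 4.11] -/
theorem seven_mul_mem_adjoin_theta_seventysix (hθ : aeval θ (csPoly 76) = 0) (h3 : finrank ℚ K = 3)
    (x : 𝓞 K) : ((7 : ℕ) : K) * x ∈ Algebra.adjoin ℤ ({θ} : Set K) := by
  obtain ⟨u, v, w, rfl⟩ := exists_int_coords_seventysix hθ h3 x
  have hθmem : θ ∈ Algebra.adjoin ℤ ({θ} : Set K) := Algebra.self_mem_adjoin_singleton ℤ θ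
  have key : ((7 : ℕ) : K) * ((u + v * thetaInt hθ + w * MonicCubic.thetaInt
      (aeval_eta_seventysix hθ) : 𝓞 K) : K) =
      (7 * u : ℤ) + (7 * v : ℤ) * θ + (w : ℤ) * (θ - 2) ^ 2 := by
    simp only [thetaInt, MonicCubic.thetaInt, map_add, map_mul,
      map_intCast, RingOfIntegers.map_mk]
    push_cast
    field_simp
  rw [key]
  refine add_mem (add_mem (intCast_mem _ _) (mul_mem (intCast_mem _ _) hθmem))
    (mul_mem (intCast_mem _ _) (pow_mem (sub_mem hθmem ?_) 2))
  exact_mod_cast (intCast_mem (Algebra.adjoin ℤ ({θ} : Set K)) 2)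

/-- **`η ∉ ℤ[θ]`** ("`ℤ[Θ_{49k+27}]` is not integrally closed"): `7(u + vθ + wθ²) = (θ - 2)²` would force
`7w = 1`. [cite: KimYamada2023, §4.2 Prop. 4.11] -/
theorem eta_not_mem_adjoin_theta_seventysix (hθ : aeval θ (csPoly 76) = 0) (h3 : finrank ℚ K = 3) :
    (θ - 2) ^ 2 / 7 ∉ Algebra.adjoin ℤ ({θ} : Set K) := by
  intro hmem
  obtain ⟨u, v, w, huvw⟩ := MonicCubic.exists_coords_of_mem_adjoin (aeval_poly_seventysix hθ) hmem
  have h7 : ((4 : ℤ) : K) + ((-4 : ℤ) : K) * θ + ((1 : ℤ) : K) * θ ^ 2 =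
      ((7 * u : ℤ) : K) + ((7 * v : ℤ) : K) * θ + ((7 * w : ℤ) : K) * θ ^ 2 := by
    have : (θ - 2) ^ 2 = 7 * (u + v * θ + w * θ ^ 2) := by
      rw [← huvw]; field_simp
    push_cast
    linear_combination this
  obtain ⟨-, -, hw⟩ := MonicCubic.int_coords_unique irreducible_polyQ_seventysix
    (aeval_poly_seventysix hθ) h3 h7
  omega

/-- Hence **`ℤ[θ] ≠ 𝓞 K`** for the trace `76` field (Kim–Yamada, Prop. 4.11, `k = 1`; Iwaki,
Ex. 3.13, `(c, p, n₀) = (2, 7, 27)`). [cite: KimYamada2023, §4.2 Prop. 4.11] -/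
theorem adjoin_thetaInt_ne_top_seventysix (hθ : aeval θ (csPoly 76) = 0) (h3 : finrank ℚ K = 3) :
    Algebra.adjoin ℤ ({thetaInt hθ} : Set (𝓞 K)) ≠ ⊤ := by
  intro htop
  have hmem : MonicCubic.thetaInt (aeval_eta_seventysix hθ) ∈
      Algebra.adjoin ℤ ({thetaInt hθ} : Set (𝓞 K)) := by rw [htop]; exact Algebra.mem_top
  rw [Algebra.adjoin_singleton_eq_range_aeval] at hmem
  obtain ⟨g, hg⟩ := hmem
  apply eta_not_mem_adjoin_theta_seventysix hθ h3
  rw [Algebra.adjoin_singleton_eq_range_aeval]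
  refine ⟨g, ?_⟩
  change aeval (thetaInt hθ) g = _ at hg
  change aeval θ g = _
  have h := congrArg (algebraMap (𝓞 K) K) hg
  rw [← aeval_algebraMap_apply] at h
  simpa [thetaInt, MonicCubic.thetaInt, RingOfIntegers.map_mk] using h

/-- **Dedekind–Kummer applies at every `p ≠ 7`**: `p ∤ exponent(θ)` for every prime `p ≠ 7`
(`7 · 𝓞 K ⊆ ℤ[θ]`, Marcus, Ex. 3.20). [cite: Marcus2018, Ch. 3, Thm. 27 and Exercise 20] -/
theorem not_dvd_exponent_seventysix (hθ : aeval θ (csPoly 76) = 0) (h3 : finrank ℚ K = 3)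
    {p : ℕ} (hp : p.Prime) (hp7 : p ≠ 7) : ¬ p ∣ RingOfIntegers.exponent (thetaInt hθ) :=
  not_dvd_exponent_of_mul_mem hθ (seven_mul_mem_adjoin_theta_seventysix hθ h3)
    fun h => hp7 ((Nat.prime_dvd_prime_iff_eq hp (by norm_num)).mp h)

/-- **`3 · 𝓞 K ⊆ ℤ[ω]`**, `ω = (θ² - 74θ + 4)/7`: `3(u + vθ + wη) = 3u + v(ω² + 9ω - 4) +
w(10ω² + 93ω - 40)`. [cite: KimYamada2023, §4.2 Prop. 4.11 (proof)] -/
theorem three_mul_mem_adjoin_omega_seventysix (hθ : aeval θ (csPoly 76) = 0) (h3 : finrank ℚ K = 3)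
    (x : 𝓞 K) : ((3 : ℕ) : K) * x ∈ Algebra.adjoin ℤ ({(θ ^ 2 - 74 * θ + 4) / 7} : Set K) := by
  obtain ⟨u, v, w, rfl⟩ := exists_int_coords_seventysix hθ h3 x
  set ω : K := (θ ^ 2 - 74 * θ + 4) / 7 with hω
  have hωmem : ω ∈ Algebra.adjoin ℤ ({ω} : Set K) := Algebra.self_mem_adjoin_singleton ℤ ω
  have h3t := congrArg (algebraMap (𝓞 K) K) (three_mul_thetaInt_seventysix hθ)
  have h3e := congrArg (algebraMap (𝓞 K) K) (three_mul_etaInt_seventysix hθ)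
  simp only [thetaInt, MonicCubic.thetaInt, map_sub, map_mul, map_add, map_pow, map_ofNat,
    RingOfIntegers.map_mk] at h3t h3e
  have key : ((3 : ℕ) : K) * ((u + v * thetaInt hθ + w * MonicCubic.thetaInt
      (aeval_eta_seventysix hθ) : 𝓞 K) : K) =
      (3 * u : ℤ) + (v : ℤ) * (ω ^ 2 + 9 * ω - 4) + (w : ℤ) * (10 * ω ^ 2 + 93 * ω - 40) := by
    simp only [thetaInt, MonicCubic.thetaInt, map_add, map_mul,
      map_intCast, RingOfIntegers.map_mk]
    rw [hω, ← h3t, ← h3e]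
    push_cast
    ring
  rw [key]
  refine add_mem (add_mem (intCast_mem _ _) (mul_mem (intCast_mem _ _) ?_))
    (mul_mem (intCast_mem _ _) ?_)
  · refine sub_mem (add_mem (pow_mem hωmem 2) (mul_mem ?_ hωmem)) ?_
    · exact_mod_cast (intCast_mem (Algebra.adjoin ℤ ({ω} : Set K)) 9)
    · exact_mod_cast (intCast_mem (Algebra.adjoin ℤ ({ω} : Set K)) 4)
  · refine sub_mem (add_mem (mul_mem ?_ (pow_mem hωmem 2)) (mul_mem ?_ hωmem)) ?_
    · exact_mod_cast (intCast_mem (Algebra.adjoin ℤ ({ω} : Set K)) 10)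
    · exact_mod_cast (intCast_mem (Algebra.adjoin ℤ ({ω} : Set K)) 93)
    · exact_mod_cast (intCast_mem (Algebra.adjoin ℤ ({ω} : Set K)) 40)

/-! ### The residue maps at the primes above `7` and the conductor square `𝓞 K/(7, θ - 2) ≅ 𝔽₇²` -/

/-- **The residue maps at the two primes above `7`**: for `τ = 1` and `τ = 4` (the roots of
`x³ - 2x² - 109x + 47` modulo `7`) there is a ring homomorphism `ψ : 𝓞 K → 𝔽₇` with `ψ(ω) = τ`,
hence `ψ(θ) = 2` and `ψ(η) = τ + 20` (`= 0`, resp. `3`): the primes `𝔭 = ker ψ₁ ∋ η` and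
`𝔮 = ker ψ₄ ∋ η - 3` above `7 𝓞 K = 𝔭𝔮²`. [cite: Iwaki2025, Thm. 3.11 and Ex. 3.13 ((c,p) = (2,7): ⟨θₙ - 2, 7⟩ is not invertible)] -/
theorem exists_ringHom_zmod_seven_seventysix (hθ : aeval θ (csPoly 76) = 0) (h3 : finrank ℚ K = 3)
    {τ : ZMod 7} (hτ : τ = 1 ∨ τ = 4) :
    ∃ ψ : 𝓞 K →+* ZMod 7, ψ (thetaInt hθ) = 2 ∧
      ψ (MonicCubic.thetaInt (aeval_eta_seventysix hθ)) = τ + 20 ∧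
      ψ (MonicCubic.thetaInt (aeval_omega_seventysix hθ)) = τ := by
  have hτroot : τ ^ 3 + ((-2 : ℤ) : ZMod 7) * τ ^ 2 + ((-109 : ℤ) : ZMod 7) * τ +
      ((47 : ℤ) : ZMod 7) = 0 := by
    rcases hτ with rfl | rfl <;> decide
  obtain ⟨ψ, hψ⟩ := MonicCubic.exists_ringHom_of_root_of_mul_mem irreducible_polyQ_omega_seventysix
    (aeval_omega_seventysix hθ) h3 (three_mul_mem_adjoin_omega_seventysix hθ h3) τ hτroot 5
    (by decide)
  have h3t := congrArg ψ (three_mul_thetaInt_seventysix hθ)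
  simp only [map_mul, map_add, map_sub, map_pow, map_ofNat, hψ] at h3t
  have ht : ψ (thetaInt hθ) = 2 := by
    have key : ∀ z : ZMod 7, 3 * z = τ ^ 2 + 9 * τ - 4 → z = 2 := by
      rcases hτ with rfl | rfl <;> decide
    exact key _ h3t
  refine ⟨ψ, ht, ?_, hψ⟩
  have he := congrArg ψ (omegaInt_eq_seventysix hθ)
  rw [map_sub, map_mul, map_ofNat, hψ, ht] at he
  linear_combination (-1 : ZMod 7) * he

/-- **The common kernel of the two residue maps is the conductor ideal `7 𝓞 K + (θ - 2) 𝓞 K`**: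
if `ψ(θ) = 2`, `ψ(η) = 0` and `ψ'(θ) = 2`, `ψ'(η) = 3`, then `ψ z = 0 = ψ' z` forces
`z = 7 o₁ + (θ - 2) o₂` (coordinates: `z = u + vθ + wη ↦ u + 2v`, `u + 2v + 3w`).
[cite: KimYamada2023, §4.3 Prop. 4.12 (the conductor of ℤ[Θ₂₇]-type orders)] -/
theorem exists_of_residues_eq_zero_seventysix (hθ : aeval θ (csPoly 76) = 0) (h3 : finrank ℚ K = 3)
    {ψ ψ' : 𝓞 K →+* ZMod 7} (hψt : ψ (thetaInt hθ) = 2)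
    (hψe : ψ (MonicCubic.thetaInt (aeval_eta_seventysix hθ)) = 0) (hψ't : ψ' (thetaInt hθ) = 2)
    (hψ'e : ψ' (MonicCubic.thetaInt (aeval_eta_seventysix hθ)) = 3) {z : 𝓞 K} (h0 : ψ z = 0)
    (h0' : ψ' z = 0) :
    ∃ o₁ o₂ : 𝓞 K, z = 7 * o₁ + (thetaInt hθ - 2) * o₂ := by
  obtain ⟨u, v, w, rfl⟩ := exists_int_coords_seventysix hθ h3 z
  simp only [map_add, map_mul, map_intCast, hψt, hψe, hψ't, hψ'e, mul_zero, add_zero] at h0 h0'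
  have hw : ((w : ℤ) : ZMod 7) = 0 := by
    have : (3 : ZMod 7) * w = 0 := by linear_combination h0' - h0
    have key : ∀ a : ZMod 7, 3 * a = 0 → a = 0 := by decide
    exact key _ this
  have huv : (((u + 2 * v : ℤ)) : ZMod 7) = 0 := by push_cast; linear_combination h0
  obtain ⟨w', rfl⟩ := (ZMod.intCast_zmod_eq_zero_iff_dvd w 7).mp hw
  obtain ⟨k, hk⟩ := (ZMod.intCast_zmod_eq_zero_iff_dvd (u + 2 * v) 7).mp huv
  refine ⟨k + w' * MonicCubic.thetaInt (aeval_eta_seventysix hθ), v, ?_⟩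
  have hu : (u : 𝓞 K) = 7 * k - 2 * v := by
    have : (u : ℤ) = 7 * k - 2 * v := by push_cast at hk; omega
    rw [this]; push_cast; ring
  rw [hu]; push_cast; ring

omit [NumberField K] in
/-- Conversely the conductor ideal lies in both kernels: `ψ(7 o₁ + (θ - 2) o₂) = 0` whenever
`ψ(θ) = 2`. [cite: KimYamada2023, §4.3 Prop. 4.12] -/
theorem residue_eq_zero_of_mem_conductor_seventysix (hθ : aeval θ (csPoly 76) = 0)
    {ψ : 𝓞 K →+* ZMod 7} (hψt : ψ (thetaInt hθ) = 2) (o₁ o₂ : 𝓞 K) :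
    ψ (7 * o₁ + (thetaInt hθ - 2) * o₂) = 0 := by
  simp only [map_add, map_mul, map_sub, map_ofNat, hψt]
  have h7 : (7 : ZMod 7) = 0 := by decide
  rw [h7]; ring

/-- **The conductor contains `7` and `θ - 2`**: `7 · 𝓞 K ⊆ ℤ[θ]` and `(θ - 2) · 𝓞 K ⊆ ℤ[θ]`
(`(θ - 2) η = 10θ² - 9θ - 1`), inside `𝓞 K`. [cite: KimYamada2023, §4.3 Prop. 4.12] -/
theorem conductor_mul_mem_adjoin_seventysix (hθ : aeval θ (csPoly 76) = 0) (h3 : finrank ℚ K = 3)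
    (o₁ o₂ : 𝓞 K) :
    7 * o₁ + (thetaInt hθ - 2) * o₂ ∈ Algebra.adjoin ℤ ({thetaInt hθ} : Set (𝓞 K)) := by
  have rel := thetaInt_rel_seventysix hθ
  have he := seven_mul_etaInt_seventysix hθ
  have hte := thetaInt_mul_etaInt_seventysix hθ
  have htmem : thetaInt hθ ∈ Algebra.adjoin ℤ ({thetaInt hθ} : Set (𝓞 K)) :=
    Algebra.self_mem_adjoin_singleton ℤ _
  obtain ⟨u₁, v₁, w₁, rfl⟩ := exists_int_coords_seventysix hθ h3 o₁
  obtain ⟨u₂, v₂, w₂, rfl⟩ := exists_int_coords_seventysix hθ h3 o₂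
  set t := thetaInt hθ
  set e := MonicCubic.thetaInt (aeval_eta_seventysix hθ)
  -- `7e = (t - 2)²` and `(t - 2) e = 10t² - 9t - 1`
  have key : 7 * (u₁ + v₁ * t + w₁ * e) + (t - 2) * (u₂ + v₂ * t + w₂ * e) =
      (7 * u₁ + 4 * w₁ - 2 * u₂ - w₂ : ℤ) + (7 * v₁ - 4 * w₁ + u₂ - 2 * v₂ - 9 * w₂ : ℤ) * t +
        (w₁ + v₂ + 10 * w₂ : ℤ) * t ^ 2 := by
    push_cast
    linear_combination ((w₁ : 𝓞 K) + 10 * (w₂ : 𝓞 K)) * he + (w₂ : 𝓞 K) * hte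
  rw [key]
  exact add_mem (add_mem (intCast_mem _ _) (mul_mem (intCast_mem _ _) htmem))
    (mul_mem (intCast_mem _ _) (pow_mem htmem 2))

/-! ### The primes above `7`: `7 𝓞 K = 𝔭 𝔮²`, `𝔭 = (7, η) = ker ψ₁`, `𝔮 = (7, η - 3) = ker ψ₄` -/

/-- **`(7, η) · (7, η - 3) = (7, θ - 2)`**: the product of the two primes above `7` is the conductor ideal `𝔭𝔮 = (7, θ - 2) 𝓞 K`. [cite: KimYamada2023, §4.3 Prop. 4.12 (the conductor square at 7)] -/
theorem span_seven_eta_mul_span_seven_eta_sub_three_seventysix (hθ : aeval θ (csPoly 76) = 0) :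
    span {(7 : 𝓞 K), MonicCubic.thetaInt (aeval_eta_seventysix hθ)} * span {(7 : 𝓞 K), MonicCubic.thetaInt (aeval_eta_seventysix hθ) - 3} = span {(7 : 𝓞 K), thetaInt hθ - 2} := by
  have rel := thetaInt_rel_seventysix hθ
  have he := seven_mul_etaInt_seventysix hθ
  have h7 : (7 : 𝓞 K) ≠ 0 := by exact_mod_cast (by norm_num : (7 : ℕ) ≠ 0)
  set t := thetaInt hθ
  set e := MonicCubic.thetaInt (aeval_eta_seventysix hθ)
  have h1 : (7 : 𝓞 K) * (7 : 𝓞 K) = (t + 2 * e + 5) * (7 : 𝓞 K) + (-2 * t - 3) * (t - 2) := by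
    refine mul_left_cancel₀ (pow_ne_zero 1 h7) ?_
    linear_combination (-14) * he
  have h2 : (7 : 𝓞 K) * (e - 3) = (e - 3) * (7 : 𝓞 K) + (0 : 𝓞 K) * (t - 2) := by
    ring
  have h3 : e * (7 : 𝓞 K) = e * (7 : 𝓞 K) + (0 : 𝓞 K) * (t - 2) := by
    ring
  have h4 : e * (e - 3) = (2 * e) * (7 : 𝓞 K) + (2 * t + 10 * e - 1) * (t - 2) := by
    refine mul_left_cancel₀ (pow_ne_zero 2 h7) ?_
    linear_combination (t ^ 2 - 74 * t + 7 * e + 25) * he + (t - 2) * rel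
  have he' : (7 : 𝓞 K) = (1 : 𝓞 K) * ((7 : 𝓞 K) * (7 : 𝓞 K)) + (e + 2) * ((7 : 𝓞 K) * (e - 3)) + (-e + 1) * (e * (7 : 𝓞 K)) + (0 : 𝓞 K) * (e * (e - 3)) := by
    ring
  have hf' : (t - 2) = (-t - 3 * e + 2) * ((7 : 𝓞 K) * (7 : 𝓞 K)) + (t + e) * ((7 : 𝓞 K) * (e - 3)) + (-5 * t - e) * (e * (7 : 𝓞 K)) + (3 : 𝓞 K) * (e * (e - 3)) := by
    refine mul_left_cancel₀ (pow_ne_zero 2 h7) ?_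
    linear_combination (-3 * t ^ 2 + 208 * t - 21 * e + 1227) * he + (-3 * t - 8) * rel
  exact span_pair_mul_span_pair_eq_span_pair h1 h2 h3 h4 he' hf'

/-- **`(7, θ - 2) · (7, η - 3) = (7)`**, so that `7 𝓞 K = 𝔭 𝔮²` with `𝔭 = (7, η)`, `𝔮 = (7, η - 3)` (the prime `7` divides the index and is NOT covered by Dedekind–Kummer; `f₇₆ ≡ (x - 2)³ (mod 7)`). [cite: KimYamada2023, §4.2 Prop. 4.10 (fₙ ≡ (x-2)³ mod 7 for n ≡ 6 mod 7)] -/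
theorem span_seven_theta_sub_two_mul_span_seven_eta_sub_three_seventysix (hθ : aeval θ (csPoly 76) = 0) :
    span {(7 : 𝓞 K), thetaInt hθ - 2} * span {(7 : 𝓞 K), MonicCubic.thetaInt (aeval_eta_seventysix hθ) - 3} = span {(7 : 𝓞 K)} := by
  have rel := thetaInt_rel_seventysix hθ
  have he := seven_mul_etaInt_seventysix hθ
  have h7 : (7 : 𝓞 K) ≠ 0 := by exact_mod_cast (by norm_num : (7 : ℕ) ≠ 0)
  set t := thetaInt hθ
  set e := MonicCubic.thetaInt (aeval_eta_seventysix hθ)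
  have h1 : (7 : 𝓞 K) * (7 : 𝓞 K) = (7 : 𝓞 K) * (7 : 𝓞 K) := by
    ring
  have h2 : (7 : 𝓞 K) * (e - 3) = (7 : 𝓞 K) * (e - 3) := by
    ring
  have h3 : (t - 2) * (7 : 𝓞 K) = (7 : 𝓞 K) * (t - 2) := by
    ring
  have h4 : (t - 2) * (e - 3) = (7 : 𝓞 K) * (4 * t + 10 * e - 5) := by
    refine mul_left_cancel₀ (pow_ne_zero 1 h7) ?_
    linear_combination (t - 72) * he + (1 : 𝓞 K) * rel
  have h : (7 : 𝓞 K) = (-t - 2 * e) * ((7 : 𝓞 K) * (7 : 𝓞 K)) + (-e - 2) * ((7 : 𝓞 K) * (e - 3)) + (-2 * t - 1) * ((t - 2) * (7 : 𝓞 K)) + (t + 1) * ((t - 2) * (e - 3)) := by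
    refine mul_left_cancel₀ (pow_ne_zero 2 h7) ?_
    linear_combination (-21 * t + 49 * e + 679) * he + (-21 : 𝓞 K) * rel
  exact span_pair_mul_span_pair_eq_span_singleton h1 h2 h3 h4 h

/-- **`𝔭 = (7, η)` is the kernel of the residue map with `η ↦ 0`** (`θ - 2 ∈ 𝔭𝔮 ⊆ 𝔭`; coordinates).
[cite: KimYamada2023, §4.3 Prop. 4.12] -/
theorem ker_eq_span_seven_eta_seventysix (hθ : aeval θ (csPoly 76) = 0) (h3 : finrank ℚ K = 3)
    {ψ : 𝓞 K →+* ZMod 7} (hψt : ψ (thetaInt hθ) = 2)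
    (hψe : ψ (MonicCubic.thetaInt (aeval_eta_seventysix hθ)) = 0) :
    RingHom.ker ψ = span {(7 : 𝓞 K), MonicCubic.thetaInt (aeval_eta_seventysix hθ)} := by
  have h7z : (7 : ZMod 7) = 0 := by decide
  apply le_antisymm
  · intro z hz
    rw [RingHom.mem_ker] at hz
    obtain ⟨u, v, w, rfl⟩ := exists_int_coords_seventysix hθ h3 z
    simp only [map_add, map_mul, map_intCast, hψt, hψe, mul_zero, add_zero] at hz
    have huv : (((u + 2 * v : ℤ)) : ZMod 7) = 0 := by push_cast; linear_combination hz
    obtain ⟨k, hk⟩ := (ZMod.intCast_zmod_eq_zero_iff_dvd (u + 2 * v) 7).mp huv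
    have hu : (u : 𝓞 K) = 7 * k - 2 * v := by
      have : (u : ℤ) = 7 * k - 2 * v := by push_cast at hk; omega
      rw [this]; push_cast; ring
    have ht2 : thetaInt hθ - 2 ∈ span {(7 : 𝓞 K), MonicCubic.thetaInt (aeval_eta_seventysix hθ)} := by
      have h := Ideal.mul_le_right (I := span {(7 : 𝓞 K), MonicCubic.thetaInt (aeval_eta_seventysix hθ)})
        (J := span {(7 : 𝓞 K), MonicCubic.thetaInt (aeval_eta_seventysix hθ) - 3})
      rw [span_seven_eta_mul_span_seven_eta_sub_three_seventysix hθ] at h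
      exact h (Ideal.subset_span (by simp))
    have e1 : (u : 𝓞 K) + v * thetaInt hθ + w * MonicCubic.thetaInt (aeval_eta_seventysix hθ) =
        k * 7 + v * (thetaInt hθ - 2) + w * MonicCubic.thetaInt (aeval_eta_seventysix hθ) := by
      rw [hu]; ring
    rw [e1]
    exact add_mem (add_mem (Ideal.mul_mem_left _ _ (Ideal.subset_span (by simp)))
      (Ideal.mul_mem_left _ _ ht2)) (Ideal.mul_mem_left _ _ (Ideal.subset_span (by simp)))
  · rw [Ideal.span_le]
    rintro x hx
    simp only [Set.mem_insert_iff, Set.mem_singleton_iff] at hx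
    rcases hx with rfl | rfl
    · rw [SetLike.mem_coe, RingHom.mem_ker, map_ofNat, h7z]
    · rw [SetLike.mem_coe, RingHom.mem_ker, hψe]

/-- **`𝔮 = (7, η - 3)` is the kernel of the residue map with `η ↦ 3`.** [cite: KimYamada2023, §4.3 Prop. 4.12] -/
theorem ker_eq_span_seven_eta_sub_three_seventysix (hθ : aeval θ (csPoly 76) = 0)
    (h3 : finrank ℚ K = 3) {ψ : 𝓞 K →+* ZMod 7} (hψt : ψ (thetaInt hθ) = 2)
    (hψe : ψ (MonicCubic.thetaInt (aeval_eta_seventysix hθ)) = 3) :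
    RingHom.ker ψ = span {(7 : 𝓞 K), MonicCubic.thetaInt (aeval_eta_seventysix hθ) - 3} := by
  have h7z : (7 : ZMod 7) = 0 := by decide
  apply le_antisymm
  · intro z hz
    rw [RingHom.mem_ker] at hz
    obtain ⟨u, v, w, rfl⟩ := exists_int_coords_seventysix hθ h3 z
    simp only [map_add, map_mul, map_intCast, hψt, hψe] at hz
    have huv : (((u + 2 * v + 3 * w : ℤ)) : ZMod 7) = 0 := by push_cast; linear_combination hz
    obtain ⟨k, hk⟩ := (ZMod.intCast_zmod_eq_zero_iff_dvd (u + 2 * v + 3 * w) 7).mp huv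
    have hu : (u : 𝓞 K) = 7 * k - 2 * v - 3 * w := by
      have : (u : ℤ) = 7 * k - 2 * v - 3 * w := by push_cast at hk; omega
      rw [this]; push_cast; ring
    have ht2 : thetaInt hθ - 2 ∈
        span {(7 : 𝓞 K), MonicCubic.thetaInt (aeval_eta_seventysix hθ) - 3} := by
      have h := Ideal.mul_le_left (I := span {(7 : 𝓞 K), MonicCubic.thetaInt (aeval_eta_seventysix hθ)})
        (J := span {(7 : 𝓞 K), MonicCubic.thetaInt (aeval_eta_seventysix hθ) - 3})
      rw [span_seven_eta_mul_span_seven_eta_sub_three_seventysix hθ] at h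
      exact h (Ideal.subset_span (by simp))
    have e1 : (u : 𝓞 K) + v * thetaInt hθ + w * MonicCubic.thetaInt (aeval_eta_seventysix hθ) =
        k * 7 + v * (thetaInt hθ - 2) + w * (MonicCubic.thetaInt (aeval_eta_seventysix hθ) - 3) := by
      rw [hu]; ring
    rw [e1]
    exact add_mem (add_mem (Ideal.mul_mem_left _ _ (Ideal.subset_span (by simp)))
      (Ideal.mul_mem_left _ _ ht2)) (Ideal.mul_mem_left _ _ (Ideal.subset_span (by simp)))
  · rw [Ideal.span_le]
    rintro x hx
    simp only [Set.mem_insert_iff, Set.mem_singleton_iff] at hx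
    rcases hx with rfl | rfl
    · rw [SetLike.mem_coe, RingHom.mem_ker, map_ofNat, h7z]
    · rw [SetLike.mem_coe, RingHom.mem_ker, map_sub, map_ofNat, hψe]; decide

/-- **The primes above `7` are `𝔭 = (7, η)` and `𝔮 = (7, η - 3)`**: a prime `P ∋ 7` contains
`𝔭𝔮 · 𝔮 = (7)`, hence `𝔭` or `𝔮`, which are maximal (kernels of maps onto `𝔽₇`).
[cite: KimYamada2023, §4.2 Prop. 4.10–4.11 (the prime 7 in the traces 49k + 27)] -/
theorem eq_P7_or_eq_Q7_seventysix (hθ : aeval θ (csPoly 76) = 0) (h3 : finrank ℚ K = 3)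
    {P : Ideal (𝓞 K)} (hP : P ∈ primesOver (span {((7 : ℕ) : ℤ)}) (𝓞 K)) :
    P = span {(7 : 𝓞 K), MonicCubic.thetaInt (aeval_eta_seventysix hθ)} ∨
      P = span {(7 : 𝓞 K), MonicCubic.thetaInt (aeval_eta_seventysix hθ) - 3} := by
  obtain ⟨ψ₁, hψ₁t, hψ₁e, -⟩ := exists_ringHom_zmod_seven_seventysix hθ h3 (τ := 1) (Or.inl rfl)
  obtain ⟨ψ₄, hψ₄t, hψ₄e, -⟩ := exists_ringHom_zmod_seven_seventysix hθ h3 (τ := 4) (Or.inr rfl)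
  have hψ₁e' : ψ₁ (MonicCubic.thetaInt (aeval_eta_seventysix hθ)) = 0 := by rw [hψ₁e]; decide
  have hψ₄e' : ψ₄ (MonicCubic.thetaInt (aeval_eta_seventysix hθ)) = 3 := by rw [hψ₄e]; decide
  have hk₁ := ker_eq_span_seven_eta_seventysix hθ h3 hψ₁t hψ₁e'
  have hk₄ := ker_eq_span_seven_eta_sub_three_seventysix hθ h3 hψ₄t hψ₄e'
  haveI : Fact (Nat.Prime 7) := ⟨by norm_num⟩
  have hmax₁ : (span {(7 : 𝓞 K), MonicCubic.thetaInt (aeval_eta_seventysix hθ)}).IsMaximal := by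
    rw [← hk₁]; exact RingHom.ker_isMaximal_of_surjective ψ₁ (ZMod.ringHom_surjective ψ₁)
  have hmax₄ : (span {(7 : 𝓞 K), MonicCubic.thetaInt (aeval_eta_seventysix hθ) - 3}).IsMaximal := by
    rw [← hk₄]; exact RingHom.ker_isMaximal_of_surjective ψ₄ (ZMod.ringHom_surjective ψ₄)
  haveI := hP.1
  have h7 : (7 : 𝓞 K) ∈ P := by
    have hu : ((7 : ℕ) : ℤ) ∈ P.under ℤ := by
      rw [← hP.2.over]; exact Ideal.mem_span_singleton_self _
    simpa using hu
  have hPne : P ≠ ⊤ := hP.1.ne_top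
  -- `P ⊇ (7) = (7, θ - 2)(7, η - 3) = (7, η)(7, η - 3)(7, η - 3)`
  have hprod : span {(7 : 𝓞 K), MonicCubic.thetaInt (aeval_eta_seventysix hθ)} *
      span {(7 : 𝓞 K), MonicCubic.thetaInt (aeval_eta_seventysix hθ) - 3} *
        span {(7 : 𝓞 K), MonicCubic.thetaInt (aeval_eta_seventysix hθ) - 3} ≤ P := by
    rw [span_seven_eta_mul_span_seven_eta_sub_three_seventysix hθ,
      span_seven_theta_sub_two_mul_span_seven_eta_sub_three_seventysix hθ, Ideal.span_singleton_le_iff_mem]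
    exact h7
  rcases hP.1.mul_le.mp hprod with h | h
  · rcases hP.1.mul_le.mp h with h' | h'
    · exact Or.inl (hmax₁.eq_of_le hPne h').symm
    · exact Or.inr (hmax₄.eq_of_le hPne h').symm
  · exact Or.inr (hmax₄.eq_of_le hPne h).symm

/-- `𝔭 = (7, η) ≠ 𝔮 = (7, η - 3)` (`η - 3 ∉ 𝔭`: `ψ₁(η - 3) = -3 ≠ 0`). [cite: KimYamada2023, §4.2 Prop. 4.10] -/
theorem span_seven_eta_ne_seventysix (hθ : aeval θ (csPoly 76) = 0) (h3 : finrank ℚ K = 3) :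
    span {(7 : 𝓞 K), MonicCubic.thetaInt (aeval_eta_seventysix hθ)} ≠
      span {(7 : 𝓞 K), MonicCubic.thetaInt (aeval_eta_seventysix hθ) - 3} := by
  obtain ⟨ψ₁, hψ₁t, hψ₁e, -⟩ := exists_ringHom_zmod_seven_seventysix hθ h3 (τ := 1) (Or.inl rfl)
  have hψ₁e' : ψ₁ (MonicCubic.thetaInt (aeval_eta_seventysix hθ)) = 0 := by rw [hψ₁e]; decide
  intro h
  have hmem : MonicCubic.thetaInt (aeval_eta_seventysix hθ) - 3 ∈
      span {(7 : 𝓞 K), MonicCubic.thetaInt (aeval_eta_seventysix hθ)} := by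
    rw [h]; exact Ideal.subset_span (by simp)
  rw [← ker_eq_span_seven_eta_seventysix hθ h3 hψ₁t hψ₁e', RingHom.mem_ker, map_sub, hψ₁e',
    map_ofNat] at hmem
  revert hmem; decide

/-! ### Totally real, `d_K = 594881`, `⌊M_K⌋ ≤ 171` -/

/-- `K` is totally real. [cite: AitchisonRubinstein1984, Appendix (f_a has three real roots for a ≥ 6)] -/
theorem nrComplexPlaces_eq_zero_seventysix (hθ : aeval θ (csPoly 76) = 0) (h3 : finrank ℚ K = 3) :
    NumberField.InfinitePlace.nrComplexPlaces K = 0 :=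
  nrComplexPlaces_eq_zero_of_csPoly hθ h3 (by norm_num)

/-- **`⌊M_K⌋ ≤ 171`**: `M_K = (2/9)√594881 < 172`. [cite: Marcus2018, Ch. 5, Cor. 2 of Thm. 37] -/
theorem floor_minkowskiBound_le_seventysix (hθ : aeval θ (csPoly 76) = 0) (h3 : finrank ℚ K = 3) :
    ⌊(4 / Real.pi) ^ NumberField.InfinitePlace.nrComplexPlaces K *
        ((finrank ℚ K).factorial / (finrank ℚ K : ℝ) ^ finrank ℚ K *
          Real.sqrt |(NumberField.discr K : ℝ)|)⌋₊ ≤ 171 := by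
  have hd : ((|NumberField.discr K| : ℤ) : ℝ) ≤ (594881 : ℕ) := by
    rw [discr_eq_seventysix hθ h3]
    norm_num
  exact floor_minkowskiBound_le_cubic_real h3 (nrComplexPlaces_eq_zero_seventysix hθ h3) hd
    (s := 772) (U := 171) (by norm_num) (by norm_num) (by norm_num)

end Field

end Literature.Topology.FourManifolds

end
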